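import Summits.AtomisticToContinuum.FouriersLaw.Theorems.LocalOhmBVLocalOhmStubGibbsTermCovarianceDecayAux4
import Summits.AtomisticToContinuum.FouriersLaw.Theorems.LocalOhmBVLocalOhmStubGibbsTermCovarianceDecayAux5
import Summits.AtomisticToContinuum.FouriersLaw.Theorems.LocalOhmBVLocalOhmStubEquilibriumPackageAux4

/-!
# Per-term covariance decay for the free finite Gibbs state (stub `stub_gibbsTermCovarianceDecay`),
# helper VI: the covariance bound for the pinned chain (window observable, one right insertion)

Helper file for crux item stmt-AtomisticToContinuum-12009 (`LocalOhmBV.LocalOhm`, line `registered`,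
stub T2 `stub_gibbsTermCovarianceDecay`); assembles `…GibbsTermCovarianceDecayAux1–5` on the phase
space of `pinnedChain ω₂ lam β γ`:

* `integrable_mul_gibbsDensity_of_polyBound` — continuous polynomially bounded observables are
  integrable against `e^{-H_N/T} dx`;
* `append_apply_eq_cons_castSucc` — index bookkeeping for the bond insertion;
* `pinnedChain_abs_U_apply_le`, `pinnedChain_abs_V_apply_le`, `pinnedChain_gibbsMeasure_U_sq_le` —
  polynomial bounds of the pinning / bond energies and `N`-uniform second moments of `U(q_t)`;
* `pinnedChain_abs_cov_window_insertion_le` (**main**) — for the free finite-volume Gibbs state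
  `μ_N = gibbsMeasure N T`, `N = e+1+m`, a continuous polynomially bounded window observable
  `G(z) = g(z|_{a', …, a'+n})` with `a' + n = e` and `N`-uniform window second moments `≤ K_G`, and a
  continuous polynomially bounded insertion observable `Ins` which, read through the gluing
  `Fin.append`, is a bond insertion `ins` on the bond `j` of the right block with bounded kernel
  `k · ins` (operator `H`): `|∫ G·Ins dμ_N - ∫ G dμ_N ∫ Ins dμ_N| ≤ C_main (θ/λ)ʲ` with
  `C_main = 24 √K_G · max(4‖[a]‖⁴/λ, 2‖[a]‖²) · ‖H‖ ‖[a]‖² / (z_*² λ)` depending only on the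
  transfer data — transport (`…Aux4`) + `abs_cov_transfer_le` (`…Aux5`).

All [folklore]; no definitions.
-/

set_option autoImplicit false

noncomputable section

namespace Summit.AtomisticToContinuum.FouriersLaw.Theorems.LocalOhmBirth.TermDecay

open MeasureTheory Filter Topology Function
open scoped BigOperators ENNReal RealInnerProductSpace
open Literature.Analysis.OperatorTheory
open Literature.MathematicalPhysics.KineticTheory.HeatConduction
open Summit.AtomisticToContinuum.FouriersLaw.Theorems.LocalOhmBirth

/-! ### Bookkeeping -/

/-- Continuous polynomially bounded observables are integrable against the Gibbs density of the
pinned chain. -/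
theorem integrable_mul_gibbsDensity_of_polyBound {ω₂ lam β : ℝ} (hω : 0 < ω₂) (hl : 0 ≤ lam)
    (hβ : 0 ≤ β) (γ : ℝ) (N : ℕ) {T : ℝ} (hT : 0 < T) {F : PhaseSpace N → ℝ} (hF : Continuous F)
    {C₀ : ℝ} {m : ℕ} (hle : ∀ x, |F x| ≤ C₀ * (1 + ‖x‖) ^ m) :
    Integrable fun x => F x * (pinnedChain ω₂ lam β γ).gibbsDensity N T x := by
  have h := integrable_gibbsMeasure_of_polyBound hω hl hβ γ N hT hF hle
  rw [OscillatorChain.gibbsMeasure_eq,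
    integrable_tilted_iff (pinnedChain_integrable_gibbsDensity hω hl hβ γ N hT)] at h
  refine h.congr (ae_of_all _ fun x => ?_)
  dsimp only
  rw [smul_eq_mul, mul_comm]
  rfl

/-- The sites of the bond `j` of the right block, read in the glued configuration: the left
endpoint `(ξ_e ∷ η)_j` is the site `e + j` of `append ξ η`. -/
theorem append_apply_eq_cons_castSucc {Y : Type*} (e m : ℕ) (ξ : Fin (e + 1) → Y) (η : Fin m → Y)
    (j : Fin m) (h : e + j.val < e + 1 + m) :
    Fin.append ξ η ⟨e + j.val, h⟩ = (Fin.cons (ξ (Fin.last e)) η : Fin (m + 1) → Y) (Fin.castSucc j) := by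
  rcases Nat.eq_zero_or_pos j.val with hj | hj
  · have h1 : (⟨e + j.val, h⟩ : Fin (e + 1 + m)) = Fin.castAdd m (Fin.last e) := Fin.ext (by simp [hj])
    have h2 : Fin.castSucc j = (0 : Fin (m + 1)) := Fin.ext (by simp [hj])
    rw [h1, Fin.append_left, h2, Fin.cons_zero]
  · have h1 : (⟨e + j.val, h⟩ : Fin (e + 1 + m)) = Fin.natAdd (e + 1) ⟨j.val - 1, by omega⟩ :=
      Fin.ext (by simp; omega)
    have hm : 0 < m := j.pos
    obtain ⟨m', rfl⟩ : ∃ m', m = m' + 1 := ⟨m - 1, by omega⟩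
    have h2 : Fin.castSucc j = (⟨j.val - 1, by omega⟩ : Fin (m' + 1)).succ := Fin.ext (by simp; omega)
    have h3 : η ⟨j.val - 1, by omega⟩ = (Fin.cons (ξ (Fin.last e)) η : Fin (m' + 1 + 1) → Y)
        ((⟨j.val - 1, by omega⟩ : Fin (m' + 1)).succ) := by rw [Fin.cons_succ]
    rw [h1, Fin.append_right, h2, h3]

/-- The window map is norm non-increasing. -/
theorem norm_window_le {N a' n : ℕ} (h : a' + n < N) (z : PhaseSpace N) :
    ‖(fun jj : Fin (n + 1) => (z.1 ⟨a' + jj.val, by omega⟩, z.2 ⟨a' + jj.val, by omega⟩))‖ ≤ ‖z‖ :=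
  (pi_norm_le_iff_of_nonneg (norm_nonneg z)).2 fun jj => by
    rw [Prod.norm_def]
    exact max_le ((norm_le_pi_norm z.1 _).trans (norm_fst_le z)) ((norm_le_pi_norm z.2 _).trans (norm_snd_le z))

/-! ### The main bound for the pinned chain -/

set_option maxHeartbeats 1600000 in
/-- **Covariance of a window observable and one right insertion under the free finite Gibbs state
of the pinned chain.** See the module docstring. -/
theorem pinnedChain_abs_cov_window_insertion_le
    {ω₂ lam β γ T : ℝ} (hω : 0 < ω₂) (hl : 0 ≤ lam) (hβ : 0 ≤ β) (hT : 0 < T)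
    {a : ℝ × ℝ → ℝ} {K₀ k : ℝ × ℝ → ℝ × ℝ → ℝ} {w : (N : ℕ) → (Fin N → ℝ × ℝ) → ℝ}
    {ρ : Measure (ℝ × ℝ)} [IsFiniteMeasure ρ]
    (ha : ∀ z, a z = Real.exp (-(z.2 ^ 2 / 2 + (pinnedChain ω₂ lam β γ).U z.1) / (4 * T)))
    (hK₀ : ∀ z z', K₀ z z' = Real.exp (-(pinnedChain ω₂ lam β γ).V (z'.1 - z.1) / T))
    (hk : ∀ z z', k z z' = a z * K₀ z z' * a z')
    (hw : ∀ (N : ℕ) (ζ : Fin N → ℝ × ℝ), w N ζ = (∏ i, a (ζ i) ^ 2) *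
      ∏ i : Fin N, ∏ j : Fin N, if j.val = i.val + 1 then K₀ (ζ i) (ζ j) else 1)
    (hρ : ρ = volume.withDensity fun z => ENNReal.ofReal (a z ^ 2))
    (ham : Measurable a) (hab : ∀ z, ‖a z‖ ≤ 1)
    {C : ℝ} (hkC : ∀ x y, ‖k x y‖ ≤ C)
    {ins : ℝ × ℝ → ℝ × ℝ → ℝ} (hkim : Measurable (uncurry fun x y => k x y * ins x y))
    (hkiC : ∀ x y, ‖k x y * ins x y‖ ≤ C)
    {A H : Lp ℝ 2 ρ →L[ℝ] Lp ℝ 2 ρ}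
    (hA : ∀ ψ : Lp ℝ 2 ρ, (A ψ : ℝ × ℝ → ℝ) =ᵐ[ρ] fun x => ∫ y, k x y * ψ y ∂ρ)
    (hH : ∀ ψ : Lp ℝ 2 ρ, (H ψ : ℝ × ℝ → ℝ) =ᵐ[ρ] fun x => ∫ y, (k x y * ins x y) * ψ y ∂ρ)
    {φ : Lp ℝ 2 ρ} {lam₀ θ : ℝ} (hφ : ‖φ‖ = 1) (hlam₀ : 0 < lam₀) (hθ0 : 0 ≤ θ) (hθ : θ ≤ lam₀)
    (hpow : ∀ (n : ℕ) (g : Lp ℝ 2 ρ), ‖(A ^ n) g - (lam₀ ^ n * ⟪φ, g⟫) • φ‖ ≤ θ ^ n * ‖g‖)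
    {zs : ℝ} (hzs : 0 < zs)
    (hz : ∀ n : ℕ, zs * lam₀ ^ n ≤
      ⟪(memLp_two_of_bound (μ := ρ) ham hab).toLp a, (A ^ n) ((memLp_two_of_bound (μ := ρ) ham hab).toLp a)⟫)
    {n : ℕ} {g : (Fin (n + 1) → ℝ × ℝ) → ℝ} (hg : Continuous g) {C₀ : ℝ} {mg : ℕ}
    (hgb : ∀ y, |g y| ≤ C₀ * (1 + ‖y‖) ^ mg) {KG : ℝ} (hKG0 : 0 ≤ KG)
    (hKG : ∀ (M i : ℕ) (h : i + n < M),
      ∫ z, (g fun jj : Fin (n + 1) => (z.1 ⟨i + jj.val, by omega⟩, z.2 ⟨i + jj.val, by omega⟩)) ^ 2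
        ∂((pinnedChain ω₂ lam β γ).gibbsMeasure M T) ≤ KG)
    (a' e m : ℕ) (hae : a' + n = e) (j : Fin m)
    {Ins : PhaseSpace (e + 1 + m) → ℝ} (hInsc : Continuous Ins) {C₁ : ℝ} {m₁ : ℕ}
    (hInsb : ∀ x, |Ins x| ≤ C₁ * (1 + ‖x‖) ^ m₁)
    (hIns : ∀ (ξ : Fin (e + 1) → ℝ × ℝ) (η : Fin m → ℝ × ℝ),
      Ins ((fun i => (Fin.append ξ η i).1), (fun i => (Fin.append ξ η i).2)) =
        ins ((Fin.cons (ξ (Fin.last e)) η : Fin (m + 1) → ℝ × ℝ) (Fin.castSucc j)) (η j)) :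
    |(∫ z, g (fun jj : Fin (n + 1) => (z.1 ⟨a' + jj.val, by omega⟩, z.2 ⟨a' + jj.val, by omega⟩)) * Ins z
        ∂((pinnedChain ω₂ lam β γ).gibbsMeasure (e + 1 + m) T)) -
      (∫ z, g (fun jj : Fin (n + 1) => (z.1 ⟨a' + jj.val, by omega⟩, z.2 ⟨a' + jj.val, by omega⟩))
        ∂((pinnedChain ω₂ lam β γ).gibbsMeasure (e + 1 + m) T)) *
      (∫ z, Ins z ∂((pinnedChain ω₂ lam β γ).gibbsMeasure (e + 1 + m) T))| ≤
      24 * Real.sqrt KG * max (4 * ‖(memLp_two_of_bound (μ := ρ) ham hab).toLp a‖ ^ 4 / lam₀)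
          (2 * ‖(memLp_two_of_bound (μ := ρ) ham hab).toLp a‖ ^ 2) * ‖H‖ *
        ‖(memLp_two_of_bound (μ := ρ) ham hab).toLp a‖ ^ 2 * (θ / lam₀) ^ (j : ℕ) / (zs ^ 2 * lam₀) := by
  set P := pinnedChain ω₂ lam β γ with hP
  -- ### kernel facts
  obtain ⟨-, -, ha0, -, -, -⟩ := siteWeight_props₂ (β := β) (γ := γ) hω.le hl hT ha
  obtain ⟨-, -, hK0, hK1, -, hkc, -, -, -⟩ := transferKernel_props₂ hω.le hl hβ hT ha hK₀ hk
  have hkm : Measurable (uncurry k) := hkc.measurable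
  -- ### the observables on the long chain
  set win : PhaseSpace (e + 1 + m) → (Fin (n + 1) → ℝ × ℝ) := fun z jj =>
    (z.1 ⟨a' + jj.val, by omega⟩, z.2 ⟨a' + jj.val, by omega⟩) with hwin
  have hwinc : Continuous win := continuous_pi fun jj =>
    ((continuous_apply _).comp continuous_fst).prodMk ((continuous_apply _).comp continuous_snd)
  have hwn : ∀ z, ‖win z‖ ≤ ‖z‖ := fun z => norm_window_le (by omega) z
  set G : PhaseSpace (e + 1 + m) → ℝ := fun z => g (win z) with hG
  have hGc : Continuous G := hg.comp hwinc
  have hC₀ : 0 ≤ C₀ := by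
    have h := hgb 0
    rw [norm_zero, add_zero, one_pow, mul_one] at h
    exact (abs_nonneg _).trans h
  have hC₁ : 0 ≤ C₁ := by
    have h := hInsb 0
    rw [norm_zero, add_zero, one_pow, mul_one] at h
    exact (abs_nonneg _).trans h
  have hGb : ∀ z, |G z| ≤ C₀ * (1 + ‖z‖) ^ mg := fun z =>
    (hgb _).trans (mul_le_mul_of_nonneg_left (pow_le_pow_left₀ (by positivity) (by linarith [hwn z]) mg) hC₀)
  have hGIb : ∀ z, |G z * Ins z| ≤ (C₀ * C₁) * (1 + ‖z‖) ^ (mg + m₁) := fun z => by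
    rw [abs_mul, pow_add]
    calc |G z| * |Ins z| ≤ (C₀ * (1 + ‖z‖) ^ mg) * (C₁ * (1 + ‖z‖) ^ m₁) :=
          mul_le_mul (hGb z) (hInsb z) (abs_nonneg _) (by positivity)
      _ = (C₀ * C₁) * ((1 + ‖z‖) ^ mg * (1 + ‖z‖) ^ m₁) := by ring
  -- ### integrability against the Gibbs density, transported
  have hGIi := integrable_mul_w_of_integrable_mul_gibbsDensity P ha hK₀ hw ham hρ (e + 1 + m)
    (integrable_mul_gibbsDensity_of_polyBound hω hl hβ γ (e + 1 + m) hT (hGc.mul hInsc) hGIb)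
  have hGi := integrable_mul_w_of_integrable_mul_gibbsDensity P ha hK₀ hw ham hρ (e + 1 + m)
    (integrable_mul_gibbsDensity_of_polyBound hω hl hβ γ (e + 1 + m) hT hGc hGb)
  have hIi := integrable_mul_w_of_integrable_mul_gibbsDensity P ha hK₀ hw ham hρ (e + 1 + m)
    (integrable_mul_gibbsDensity_of_polyBound hω hl hβ γ (e + 1 + m) hT hInsc hInsb)
  obtain ⟨hZN, hwN⟩ := integral_gibbsDensity_eq_integral_w P ha hK₀ hw ham hρ (e + 1 + m)
    (pinnedChain_integrable_gibbsDensity hω hl hβ γ (e + 1 + m) hT)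
  obtain ⟨hZl, hwl⟩ := integral_gibbsDensity_eq_integral_w P ha hK₀ hw ham hρ (e + 1)
    (pinnedChain_integrable_gibbsDensity hω hl hβ γ (e + 1) hT)
  obtain ⟨-, hwe⟩ := integral_gibbsDensity_eq_integral_w P ha hK₀ hw ham hρ e
    (pinnedChain_integrable_gibbsDensity hω hl hβ γ e hT)
  -- ### the left observable and the glued form of the three observables
  set Gl : (Fin (e + 1) → ℝ × ℝ) → ℝ := fun ξ => g fun jj : Fin (n + 1) => ξ ⟨a' + jj.val, by omega⟩ with hGl
  have hGlm : Measurable Gl :=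
    (hg.comp (continuous_pi fun jj => continuous_apply _)).measurable
  have hGapp : ∀ (ξ : Fin (e + 1) → ℝ × ℝ) (η : Fin m → ℝ × ℝ),
      G ((fun i => (Fin.append ξ η i).1), (fun i => (Fin.append ξ η i).2)) = Gl ξ := by
    intro ξ η
    rw [hG, hGl]
    dsimp only
    congr 1
    funext jj
    have hidx : (⟨a' + jj.val, by omega⟩ : Fin (e + 1 + m)) = Fin.castAdd m ⟨a' + jj.val, by omega⟩ := Fin.ext rfl
    rw [hwin]
    dsimp only
    rw [hidx, Fin.append_left]
  -- ### the window second moment on the short chain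
  set Gs : PhaseSpace (e + 1) → ℝ := fun z => g fun jj : Fin (n + 1) =>
    (z.1 ⟨a' + jj.val, by omega⟩, z.2 ⟨a' + jj.val, by omega⟩) with hGs
  have hGsc : Continuous Gs := hg.comp (continuous_pi fun jj =>
    ((continuous_apply _).comp continuous_fst).prodMk ((continuous_apply _).comp continuous_snd))
  have hGsb : ∀ z, |Gs z ^ 2| ≤ C₀ ^ 2 * (1 + ‖z‖) ^ (2 * mg) := fun z => by
    have h1 : |Gs z| ≤ C₀ * (1 + ‖z‖) ^ mg :=
      (hgb _).trans (mul_le_mul_of_nonneg_left (pow_le_pow_left₀ (by positivity)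
        (by linarith [norm_window_le (a' := a') (n := n) (by omega) z]) mg) hC₀)
    rw [abs_pow, pow_mul', ← mul_pow]
    exact pow_le_pow_left₀ (abs_nonneg _) h1 2
  have hGs2i := integrable_mul_w_of_integrable_mul_gibbsDensity P ha hK₀ hw ham hρ (e + 1)
    (F := fun z => Gs z ^ 2)
    (integrable_mul_gibbsDensity_of_polyBound hω hl hβ γ (e + 1) hT (hGsc.pow 2) hGsb)
  have hGs_unzip : ∀ ξ : Fin (e + 1) → ℝ × ℝ,
      Gs ((fun i => (ξ i).1), (fun i => (ξ i).2)) ^ 2 = Gl ξ ^ 2 := fun ξ => by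
    rw [hGs, hGl]
  have hIG : Integrable (fun ξ => Gl ξ ^ 2 * w (e + 1) ξ) (Measure.pi fun _ : Fin (e + 1) => ρ) :=
    hGs2i.congr (ae_of_all _ fun ξ => by
      show Gs ((fun i => (ξ i).1), (fun i => (ξ i).2)) ^ 2 * w (e + 1) ξ = Gl ξ ^ 2 * w (e + 1) ξ
      rw [hGs_unzip])
  have hZlpos : 0 < ∫ x, P.gibbsDensity (e + 1) T x :=
    integral_exp_pos (pinnedChain_integrable_gibbsDensity hω hl hβ γ (e + 1) hT)
  have hKG' : ∫ ξ, Gl ξ ^ 2 * w (e + 1) ξ ∂(Measure.pi fun _ : Fin (e + 1) => ρ) ≤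
      KG * ∫ ξ, w (e + 1) ξ ∂(Measure.pi fun _ : Fin (e + 1) => ρ) := by
    have h1 : ∫ ξ, Gl ξ ^ 2 * w (e + 1) ξ ∂(Measure.pi fun _ : Fin (e + 1) => ρ) =
        ∫ x, Gs x ^ 2 * P.gibbsDensity (e + 1) T x := by
      rw [integral_mul_gibbsDensity_eq_integral_w P ha hK₀ hw ham hρ (e + 1)]
    have h2 : ∫ x, Gs x ^ 2 ∂(P.gibbsMeasure (e + 1) T) =
        (∫ x, P.gibbsDensity (e + 1) T x)⁻¹ * ∫ x, Gs x ^ 2 * P.gibbsDensity (e + 1) T x :=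
      P.integral_gibbsMeasure _
    have h3 : ∫ x, Gs x ^ 2 * P.gibbsDensity (e + 1) T x =
        (∫ x, P.gibbsDensity (e + 1) T x) * ∫ x, Gs x ^ 2 ∂(P.gibbsMeasure (e + 1) T) := by
      rw [h2, ← mul_assoc, mul_inv_cancel₀ hZlpos.ne', one_mul]
    rw [h1, h3, ← hZl, mul_comm]
    exact mul_le_mul_of_nonneg_right (hKG (e + 1) a' (by omega)) hZlpos.le
  -- ### the abstract bound
  have hmain := abs_cov_transfer_le (ρ := ρ) hk hw ha0 hab hK0 hK1 ham hkm hkC hkim hkiC hA hH hφ hlam₀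
    hθ0 hθ hpow hzs hz e m j hGlm hKG0 hIG hKG' hwe hwl hwN
    (FGI := fun ζ => G ((fun i => (ζ i).1), (fun i => (ζ i).2)) * Ins ((fun i => (ζ i).1), (fun i => (ζ i).2)))
    (FG := fun ζ => G ((fun i => (ζ i).1), (fun i => (ζ i).2)))
    (FI := fun ζ => Ins ((fun i => (ζ i).1), (fun i => (ζ i).2)))
    (fun ξ η => by rw [hGapp, hIns]) (fun ξ η => by rw [hGapp])
    (fun ξ η => by rw [hIns]) hGIi hGi hIi
  -- ### back to the Gibbs measure
  have hrep : ∀ F : PhaseSpace (e + 1 + m) → ℝ, ∫ z, F z ∂(P.gibbsMeasure (e + 1 + m) T) =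
      (∫ ζ, F ((fun i => (ζ i).1), (fun i => (ζ i).2)) * w (e + 1 + m) ζ ∂(Measure.pi fun _ : Fin (e + 1 + m) => ρ)) /
        ∫ ζ, w (e + 1 + m) ζ ∂(Measure.pi fun _ : Fin (e + 1 + m) => ρ) := by
    intro F
    rw [P.integral_gibbsMeasure, integral_mul_gibbsDensity_eq_integral_w P ha hK₀ hw ham hρ (e + 1 + m), hZN,
      inv_mul_eq_div]
  rw [hrep, hrep, hrep]
  exact hmain


/-! ### Elementary pieces of the assembly -/

section PinnedPoly

variable {ω₂ lam β : ℝ}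

/-- The pinning energy of one site is polynomially bounded on phase space. -/
theorem pinnedChain_abs_U_apply_le (hω : 0 ≤ ω₂) (hl : 0 ≤ lam) (γ : ℝ) {N : ℕ} (t : Fin N)
    (z : PhaseSpace N) :
    |(pinnedChain ω₂ lam β γ).U (z.1 t)| ≤ (ω₂ / 2 + lam / 4) * (1 + ‖z‖) ^ 4 := by
  have hq : |z.1 t| ≤ 1 + ‖z‖ := by
    rw [← Real.norm_eq_abs]
    linarith [(norm_le_pi_norm z.1 t).trans (norm_fst_le z), norm_nonneg z]
  have hs1 : 1 ≤ 1 + ‖z‖ := by linarith [norm_nonneg z]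
  have hq2 : (z.1 t) ^ 2 ≤ (1 + ‖z‖) ^ 4 := by
    calc (z.1 t) ^ 2 = |z.1 t| ^ 2 := (sq_abs _).symm
      _ ≤ (1 + ‖z‖) ^ 2 := pow_le_pow_left₀ (abs_nonneg _) hq 2
      _ ≤ (1 + ‖z‖) ^ 4 := pow_le_pow_right₀ hs1 (by norm_num)
  have hq4 : (z.1 t) ^ 4 ≤ (1 + ‖z‖) ^ 4 := by
    calc (z.1 t) ^ 4 = |z.1 t| ^ 4 := by rw [← Even.pow_abs (by decide : Even 4)]
      _ ≤ (1 + ‖z‖) ^ 4 := pow_le_pow_left₀ (abs_nonneg _) hq 4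
  show |ω₂ * (z.1 t) ^ 2 / 2 + lam * (z.1 t) ^ 4 / 4| ≤ _
  rw [abs_of_nonneg (by positivity)]
  nlinarith [mul_le_mul_of_nonneg_left hq2 hω, mul_le_mul_of_nonneg_left hq4 hl]

/-- The bond energy of one bond is polynomially bounded on phase space. -/
theorem pinnedChain_abs_V_apply_le (hβ : 0 ≤ β) (γ : ℝ) {N : ℕ} (t t' : Fin N) (z : PhaseSpace N) :
    |(pinnedChain ω₂ lam β γ).V (z.1 t' - z.1 t)| ≤ (2 + 4 * β) * (1 + ‖z‖) ^ 4 := by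
  have hq : |z.1 t| ≤ ‖z‖ := by
    rw [← Real.norm_eq_abs]; exact (norm_le_pi_norm z.1 t).trans (norm_fst_le z)
  have hq' : |z.1 t'| ≤ ‖z‖ := by
    rw [← Real.norm_eq_abs]; exact (norm_le_pi_norm z.1 t').trans (norm_fst_le z)
  have hr : |z.1 t' - z.1 t| ≤ 2 * (1 + ‖z‖) := by
    calc |z.1 t' - z.1 t| ≤ |z.1 t'| + |z.1 t| := abs_sub _ _
      _ ≤ 2 * (1 + ‖z‖) := by linarith [norm_nonneg z]
  have hs1 : 1 ≤ 1 + ‖z‖ := by linarith [norm_nonneg z]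
  set r := z.1 t' - z.1 t with hrdef
  have hr2 : r ^ 2 ≤ 4 * (1 + ‖z‖) ^ 4 := by
    calc r ^ 2 = |r| ^ 2 := (sq_abs _).symm
      _ ≤ (2 * (1 + ‖z‖)) ^ 2 := pow_le_pow_left₀ (abs_nonneg _) hr 2
      _ = 4 * (1 + ‖z‖) ^ 2 := by ring
      _ ≤ 4 * (1 + ‖z‖) ^ 4 := by
          refine mul_le_mul_of_nonneg_left (pow_le_pow_right₀ hs1 (by norm_num)) (by norm_num)
  have hr4 : r ^ 4 ≤ 16 * (1 + ‖z‖) ^ 4 := by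
    calc r ^ 4 = |r| ^ 4 := by rw [← Even.pow_abs (by decide : Even 4)]
      _ ≤ (2 * (1 + ‖z‖)) ^ 4 := pow_le_pow_left₀ (abs_nonneg _) hr 4
      _ = 16 * (1 + ‖z‖) ^ 4 := by ring
  show |r ^ 2 / 2 + β * r ^ 4 / 4| ≤ _
  rw [abs_of_nonneg (by positivity)]
  nlinarith [mul_le_mul_of_nonneg_left hr4 hβ]

/-- **`N`-uniform second moments of the one-site pinning energy** under the free Gibbs state. -/
theorem pinnedChain_gibbsMeasure_U_sq_le (γ : ℝ) (hω : 0 < ω₂) (hl : 0 ≤ lam) (hβ : 0 ≤ β)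
    {T : ℝ} (hT : 0 < T) :
    ∃ KU : ℝ, 0 ≤ KU ∧ ∀ (N : ℕ) (t : Fin N),
      MemLp (fun z : PhaseSpace N => (pinnedChain ω₂ lam β γ).U (z.1 t)) 2
          ((pinnedChain ω₂ lam β γ).gibbsMeasure N T) ∧
        ∫ z, ((pinnedChain ω₂ lam β γ).U (z.1 t)) ^ 2 ∂((pinnedChain ω₂ lam β γ).gibbsMeasure N T) ≤ KU := by
  obtain ⟨M₂, hM₂0, hM₂⟩ := pinnedChain_gibbsMeasure_even_moments_le γ hω hl hβ hT 2
  obtain ⟨M₄, hM₄0, hM₄⟩ := pinnedChain_gibbsMeasure_even_moments_le γ hω hl hβ hT 4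
  refine ⟨ω₂ ^ 2 / 2 * M₂ + lam ^ 2 / 8 * M₄, by positivity, fun N t => ?_⟩
  set P := pinnedChain ω₂ lam β γ with hP
  have hUc : Continuous fun z : PhaseSpace N => P.U (z.1 t) :=
    (SpecificHeatLimit.pinnedChain_continuous_U γ).comp ((continuous_apply t).comp continuous_fst)
  have hUb := pinnedChain_abs_U_apply_le (β := β) hω.le hl γ t
  have hU2b : ∀ z : PhaseSpace N, |P.U (z.1 t) ^ 2| ≤ (ω₂ / 2 + lam / 4) ^ 2 * (1 + ‖z‖) ^ (2 * 4) := by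
    intro z
    rw [abs_pow, pow_mul', ← mul_pow]
    exact pow_le_pow_left₀ (abs_nonneg _) (hUb z) 2
  have hI2 : Integrable (fun z : PhaseSpace N => P.U (z.1 t) ^ 2) (P.gibbsMeasure N T) :=
    integrable_gibbsMeasure_of_polyBound hω hl hβ γ N hT (hUc.pow 2) hU2b
  refine ⟨(memLp_two_iff_integrable_sq hUc.aestronglyMeasurable).2 hI2, ?_⟩
  have hmono : ∀ k : ℕ, Integrable (fun z : PhaseSpace N => (z.1 t) ^ (2 * k)) (P.gibbsMeasure N T) :=
    fun k => integrable_gibbsMeasure_of_polyBound hω hl hβ γ N hT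
      (((continuous_apply t).comp continuous_fst).pow _) (C₀ := 1) (m := 2 * k) fun z => by
        rw [one_mul, abs_pow, ← Real.norm_eq_abs]
        exact pow_le_pow_left₀ (norm_nonneg _) (((norm_le_pi_norm z.1 t).trans (norm_fst_le z)).trans
          (by linarith [norm_nonneg z])) _
  have hpt : ∀ z : PhaseSpace N, P.U (z.1 t) ^ 2 ≤
      ω₂ ^ 2 / 2 * (z.1 t) ^ (2 * 2) + lam ^ 2 / 8 * (z.1 t) ^ (2 * 4) := by
    intro z
    show (ω₂ * (z.1 t) ^ 2 / 2 + lam * (z.1 t) ^ 4 / 4) ^ 2 ≤ _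
    nlinarith [sq_nonneg (ω₂ * (z.1 t) ^ 2 / 2 - lam * (z.1 t) ^ 4 / 4)]
  have hsum : Integrable (fun z : PhaseSpace N =>
      ω₂ ^ 2 / 2 * (z.1 t) ^ (2 * 2) + lam ^ 2 / 8 * (z.1 t) ^ (2 * 4)) (P.gibbsMeasure N T) :=
    ((hmono 2).const_mul (ω₂ ^ 2 / 2)).add ((hmono 4).const_mul (lam ^ 2 / 8))
  calc ∫ z, P.U (z.1 t) ^ 2 ∂(P.gibbsMeasure N T)
      ≤ ∫ z, (ω₂ ^ 2 / 2 * (z.1 t) ^ (2 * 2) + lam ^ 2 / 8 * (z.1 t) ^ (2 * 4)) ∂(P.gibbsMeasure N T) :=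
        integral_mono hI2 hsum fun z => hpt z
    _ = ω₂ ^ 2 / 2 * ∫ z, (z.1 t) ^ (2 * 2) ∂(P.gibbsMeasure N T) +
          lam ^ 2 / 8 * ∫ z, (z.1 t) ^ (2 * 4) ∂(P.gibbsMeasure N T) := by
        rw [integral_add ((hmono 2).const_mul (ω₂ ^ 2 / 2)) ((hmono 4).const_mul (lam ^ 2 / 8)),
          integral_const_mul, integral_const_mul]
    _ ≤ ω₂ ^ 2 / 2 * M₂ + lam ^ 2 / 8 * M₄ := by
        gcongr
        · exact (hM₂ N t).1
        · exact (hM₄ N t).1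

end PinnedPoly


/-- **Headline (registered helper stub).** `N`-uniform second moments of the one-site pinning
energy `U(q_t)` under the free finite-volume Gibbs state of the pinned anharmonic chain (with
square integrability), for all lengths `N` and sites `t`. -/
theorem pinnedChain_pinningEnergy_sq_moment_uniform :
    ∀ (ω₂ lam β γ : ℝ), 0 < ω₂ → 0 ≤ lam → 0 ≤ β → ∀ T : ℝ, 0 < T →
      ∃ KU : ℝ, 0 ≤ KU ∧ ∀ (N : ℕ) (t : Fin N),
        MemLp (fun z : PhaseSpace N => (pinnedChain ω₂ lam β γ).U (z.1 t)) 2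
            ((pinnedChain ω₂ lam β γ).gibbsMeasure N T) ∧
          ∫ z, ((pinnedChain ω₂ lam β γ).U (z.1 t)) ^ 2 ∂((pinnedChain ω₂ lam β γ).gibbsMeasure N T) ≤ KU := by
  intro ω₂ lam β γ hω hl hβ T hT
  exact pinnedChain_gibbsMeasure_U_sq_le γ hω hl hβ hT

end Summit.AtomisticToContinuum.FouriersLaw.Theorems.LocalOhmBirth.TermDecay

end
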